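import Mathlib
import Summits.AnomalousDissipation.AnomalousDissipation.Theses.MirrorVariety
import Literature.Analysis.FluidPDE.NSGalerkinFourier
import Literature.Analysis.FluidPDE.NSGalerkinStationary
import Literature.Analysis.FluidPDE.SteadyGalerkinApprox

/-!
# Crux `GalerkinSteadyZerothLaw` (stmt-AnomalousDissipation-2986) — ideator 2 sketch for the crux idea
`euler-core-coat-readout` (AMPLITUDE-CLAMPED EXACT-EULER CORE; THE FORCE IS READ OFF THE COAT).

Everything is stated at the coefficient level of the route (galerkinSubspace / galerkinRHS on the punctured ball
S = (freqBall N).erase 0, exactly as cruxes #3/#5 of MirrorVariety).  `galerkinRHS S ν g c = -ν A c + Π(g - B(c,c))`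
is the Galerkin ODE field; a steady state of force `g` is a zero of it.

* `IsEulerCore C`      : C real, solenoidal, nonzero, `galerkinRHS S 0 0 C = 0` (Π B(C,C) = 0: ABC, single-shell 2-D cells,
                          2.5-D single-shell Beltrami cells, shear modes).
* `IsCoat ν C h`       : h real solenoidal, L²-orthogonal to C, and the unforced residual of c = C + h is COLLINEAR with C:
                          `galerkinRHS S ν 0 (C + h) = (-s) • C` — i.e. every steady Galerkin equation orthogonal to C holds,
                          the single remaining scalar equation is NOT imposed; its residual `s` is the READOUT force amplitude.
* `readout_eq`  (FIRST LEMMA): `s * ‖C‖² = ν * enstrophy (C + h)` — the readout amplitude is the total dissipation over the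
                          core energy, in particular `s > 0`; `coat_steady`: c = C + h is an exact steady state of force s • C;
                          `gauge`: the NS scaling (c, ν, g) ↦ (c/α, ν/α, g/α²) maps steady states to steady states, so force
                          s • C at viscosity ν is force C at viscosity ν/√s.
* `LoudCoatDecades` (the transfer target C⁺) and `transfer : LoudCoatDecades → GalerkinSteadyZerothLaw` (bookkeeping:
                          readout + gauge + an intermediate-value sweep along a connected set of coats covering one viscosity
                          decade, which makes the rescaled viscosity hit a prescribed ν'_j at every large N).
`readout_eq`, `coat_steady` and `gauge` are PROVED (no sorry); only `transfer` is left `sorry` (crux-ideate stage: signatures must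
elaborate; the transfer is bookkeeping for crux-plan).
-/

set_option linter.dupNamespace false

namespace Summit.AnomalousDissipation.AnomalousDissipation.Cruxes.GalerkinSteadyZerothLaw.EulerCoreCoatReadout

open Literature.Analysis.FluidPDE Literature.Analysis.FluidPDE.Torus Literature.Analysis.FunctionSpaces.Torus
open MeasureTheory
open scoped InnerProductSpace

noncomputable section

/-- The punctured frequency ball of the crux. -/
abbrev Ball (N : ℕ) : Finset (Fin 3 → ℤ) := (freqBall N).erase 0

/-- Coefficient vectors at level `N`. -/
abbrev Coeff (N : ℕ) : Type := ↥(Ball N) → EuclideanSpace ℂ (Fin 3)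

/-- Real (L²) pairing of coefficient vectors: `Σ_k Re ⟪c k, c' k⟫`. -/
def rin {N : ℕ} (c c' : Coeff N) : ℝ := ∑ k, (inner ℂ (c k) (c' k)).re

/-- Energy `Σ_k ‖c k‖²` ( = ∫|U|² for U = realTrigPoly S c, Parseval). -/
def energy {N : ℕ} (c : Coeff N) : ℝ := ∑ k, ‖c k‖ ^ 2

/-- Enstrophy `4π² Σ_k |k|² ‖c k‖²` ( = ‖∇U‖²). -/
def enstrophy {N : ℕ} (c : Coeff N) : ℝ := 4 * Real.pi ^ 2 * ∑ k : ↥(Ball N), freqNormSq k.1 * ‖c k‖ ^ 2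

/-- Exact Euler core at level `N`: real solenoidal nonzero coefficient vector annihilated by the unforced inviscid field
(`Π B(C,C) = 0`). -/
def IsEulerCore {N : ℕ} (C : Coeff N) : Prop :=
  C ∈ galerkinSubspace (Ball N) ∧ C ≠ 0 ∧ galerkinRHS (Ball N) 0 0 C = 0

/-- Amplitude-clamped coat over the core `C` at viscosity `ν`: real solenoidal `h ⊥ C` such that the unforced residual of
`C + h` is collinear with `C` (readout amplitude `s`). -/
def IsCoat {N : ℕ} (ν : ℝ) (C h : Coeff N) : Prop :=
  h ∈ galerkinSubspace (Ball N) ∧ rin C h = 0 ∧ ∃ s : ℝ, galerkinRHS (Ball N) ν 0 (C + h) = (-s) • C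

/-- **First lemma (readout identity).** For a coat, the readout amplitude times the core energy is the TOTAL dissipation
`ν ‖∇(C+h)‖²`: pair `-νA c - ΠB(c,c) = -s C` with `c = C + h`, use `Re⟪ΠB(c,c), c⟫ = 0`
(`sum_re_inner_galerkinField_self`) and `rin C h = 0`.  Hence `s > 0` whenever `ν > 0`. -/
theorem readout_eq {N : ℕ} {ν s : ℝ} {C h : Coeff N} (hC : IsEulerCore C) (hh : h ∈ galerkinSubspace (Ball N))
    (horth : rin C h = 0) (hs : galerkinRHS (Ball N) ν 0 (C + h) = (-s) • C) :
    s * energy C = ν * enstrophy (C + h) := by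
  have hS : ∀ k ∈ Ball N, -k ∈ Ball N := neg_mem_freqBall_erase_zero
  have hc : C + h ∈ galerkinSubspace (Ball N) := (galerkinSubspace (Ball N)).add_mem hC.1 hh
  have hg : IsRealCoeff (0 : Coeff N) := ((galerkinSubspace (Ball N)).zero_mem).1
  have hid := sum_re_inner_galerkinRHS_self ν hS hg hc
  rw [hs, coeffExt_zero, realTrigPoly_zero, toReal_eGradNormSq_realTrigPoly hS (hc.1.isConjSymm_coeffExt hS),
    sum_coeffExt (fun k v => freqNormSq k * ‖v‖ ^ 2) (C + h)] at hid
  simp only [Pi.zero_apply, inner_zero_left, integral_zero, add_zero] at hid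
  -- left-hand side: Σ Re⟪(C+h) k, (-s) • C k⟫ = -s * energy C
  have hL : ∑ k : ↥(Ball N), (inner ℂ ((C + h) k) (((-s) • C) k)).re = -s * energy C := by
    have hterm : ∀ k : ↥(Ball N), (inner ℂ ((C + h) k) (((-s) • C) k)).re =
        -s * (‖C k‖ ^ 2 + (inner ℂ (h k) (C k)).re) := by
      intro k
      have e1 : ((-s) • C) k = Complex.ofReal (-s) • C k := by
        rw [Pi.smul_apply, RCLike.real_smul_eq_coe_smul (K := ℂ)]; rfl
      have e2 : (inner ℂ (C k) (C k)).re = ‖C k‖ ^ 2 := by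
        rw [← RCLike.re_to_complex, inner_self_eq_norm_sq]
      rw [e1, inner_smul_right, Pi.add_apply, inner_add_left]
      simp only [Complex.mul_re, Complex.add_re, Complex.add_im, Complex.ofReal_re, Complex.ofReal_im, zero_mul,
        sub_zero]
      rw [e2]
    rw [Finset.sum_congr rfl fun k _ => hterm k, ← Finset.mul_sum, Finset.sum_add_distrib]
    have hsym : ∑ k : ↥(Ball N), (inner ℂ (h k) (C k)).re = rin C h := by
      unfold rin
      refine Finset.sum_congr rfl fun k _ => ?_
      rw [← inner_conj_symm, Complex.conj_re]
    rw [hsym, horth, add_zero]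
    rfl
  rw [hL] at hid
  unfold enstrophy
  linarith

/-- A coat with readout `s` is an exact Galerkin steady state of the force `s • C`
(`galerkinRHS` is affine in the force: `galerkinRHS S ν g c = galerkinRHS S ν 0 c + Π g`, and `Π C = C`). -/
theorem coat_steady {N : ℕ} {ν s : ℝ} {C h : Coeff N} (hC : C ∈ galerkinSubspace (Ball N))
    (hs : galerkinRHS (Ball N) ν 0 (C + h) = (-s) • C) :
    galerkinRHS (Ball N) ν (s • C) (C + h) = 0 := by
  funext k
  have hk := congrFun hs k
  -- the Galerkin field is affine in the force: V(g, c) k = V(0, c) k + Π_k ĝ k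
  have haff : galerkinRHS (Ball N) ν (s • C) (C + h) k =
      galerkinRHS (Ball N) ν 0 (C + h) k + leraySym (k : Fin 3 → ℤ) (coeffExt (Ball N) (s • C) k) := by
    simp only [galerkinRHS_apply, galerkinField_def, coeffExt_zero, Pi.zero_apply, zero_sub, leraySym_sub, leraySym_neg]
    abel
  rw [haff, hk]
  simp only [Pi.smul_apply, Pi.zero_apply, coeffExt_coe, leraySym_real_smul,
    leraySym_of_transversal (hC.2 k), neg_smul, neg_add_cancel]

/-- **Scaling gauge.** `(c, ν, g) ↦ (α⁻¹ c, ν/α, α⁻² g)` maps Galerkin steady states to Galerkin steady states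
(`galerkinRHS` of the image is `α⁻²` times the original).  With `α = √s` a steady state of force `s • C` at viscosity `ν`
becomes one of force `C` at viscosity `ν/√s`, with energy `/s` and dissipation `/s^{3/2}`. -/
theorem gauge {N : ℕ} {ν α : ℝ} {g c : Coeff N} (hα : 0 < α) (h0 : galerkinRHS (Ball N) ν g c = 0) :
    galerkinRHS (Ball N) (ν / α) ((α ^ 2)⁻¹ • g) (α⁻¹ • c) = 0 := by
  funext k
  have hk := congrFun h0 k
  rw [galerkinRHS_apply, galerkinField_def] at hk ⊢
  rw [coeffExt_smul, coeffExt_smul]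
  set G := coeffExt (Ball N) g with hG
  set Cc := coeffExt (Ball N) c with hCc
  have hα0 : α ≠ 0 := hα.ne'
  -- real scalar actions as complex ones (with the `Complex.ofReal` coercion throughout)
  have hsc : (α⁻¹ • Cc : (Fin 3 → ℤ) → EuclideanSpace ℂ (Fin 3)) = ((α⁻¹ : ℝ) : ℂ) • Cc := by
    funext l; simp only [Pi.smul_apply, Complex.coe_smul]
  have hconv : convectionCoeff (Ball N) (α⁻¹ • Cc) (α⁻¹ • Cc) (k : Fin 3 → ℤ) =
      (α ^ 2)⁻¹ • convectionCoeff (Ball N) Cc Cc (k : Fin 3 → ℤ) := by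
    rw [hsc, convectionCoeff_smul_left, convectionCoeff_smul_right, smul_smul, ← Complex.coe_smul]
    congr 1
    push_cast
    ring
  have hstokes : -((((ν / α) * (4 * Real.pi ^ 2 * freqNormSq (k : Fin 3 → ℤ)) : ℝ) : ℂ) • (α⁻¹ • Cc) (k : Fin 3 → ℤ)) =
      (α ^ 2)⁻¹ • (-(((ν * (4 * Real.pi ^ 2 * freqNormSq (k : Fin 3 → ℤ)) : ℝ) : ℂ) • Cc (k : Fin 3 → ℤ))) := by
    rw [Pi.smul_apply, ← Complex.coe_smul, ← Complex.coe_smul, smul_smul, smul_neg, smul_smul, ← neg_smul, ← neg_smul]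
    congr 1
    push_cast
    field_simp
  rw [hconv, hstokes, Pi.smul_apply, ← smul_sub, leraySym_real_smul, ← smul_add, hk, Pi.zero_apply, smul_zero]

/-- **C⁺ = LoudCoatDecades** (the transfer target; all content of the line).  ONE exact-Euler core shape `Cfun`
supported in a fixed punctured ball `K₀`, budgets `E₁, ε₁, M`, a ratio `ρ` with `ρ² ε₁ > M`, and viscosities `νlo j → 0⁺`
such that for every `j`, FREQUENTLY in `N`, a CONNECTED set `K` of (viscosity, coat) pairs over the restricted core —
total energy `≤ E₁`, total dissipation in `[ε₁, M]` — projects ONTO the viscosity decade `[νlo j, ρ νlo j]`. -/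
def LoudCoatDecades : Prop :=
  ∃ (K₀ : ℕ) (Cfun : (Fin 3 → ℤ) → EuclideanSpace ℂ (Fin 3)), (∀ k ∉ (freqBall K₀).erase 0, Cfun k = 0) ∧
    ∃ (E₁ ε₁ M ρ : ℝ) (νlo : ℕ → ℝ), 0 < ε₁ ∧ M < ρ ^ 2 * ε₁ ∧ (∀ j, 0 < νlo j) ∧
      Filter.Tendsto νlo Filter.atTop (nhds 0) ∧
      ∀ j, ∃ᶠ N in Filter.atTop, ∃ C : Coeff N, (C = fun k : ↥(Ball N) => Cfun k.1) ∧ IsEulerCore C ∧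
        ∃ K : Set (ℝ × Coeff N), IsConnected K ∧
          (∀ p ∈ K, IsCoat p.1 C p.2 ∧ energy (C + p.2) ≤ E₁ ∧ ε₁ ≤ p.1 * enstrophy (C + p.2) ∧
            p.1 * enstrophy (C + p.2) ≤ M) ∧
          Set.Icc (νlo j) (ρ * νlo j) ⊆ Prod.fst '' K

/-- **Transfer.** `LoudCoatDecades → GalerkinSteadyZerothLaw` — force `f := realTrigPoly _ Cfun` (a real solenoidal
trigonometric polynomial: smooth, divergence free, mean zero), viscosities `ν'_j := νlo j · √(energy C / ε₁)`;
at each of the frequently many `N`: the continuous map `(ν, h) ↦ ν / enstrophy (C + h)` on the connected `K` takes a value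
`≤ νlo² / ε₁` above `ν = νlo j` and a value `≥ ρ² νlo² / M > νlo² / ε₁` above `ν = ρ νlo j`, hence (IVT) hits `νlo² / ε₁`
exactly at some `(ν, h) ∈ K`; there the readout is `s = ν·enstrophy/energy C` (`readout_eq`), the gauge with `α = √s`
turns `C + h` into a Galerkin steady state `U` of force `C` at viscosity EXACTLY `ν'_j` (`gauge`, `coat_steady`), with
`∫|U|² = energy(C+h)/s ≤ E₁·energy C/ε₁` and `ν'_j ‖∇U‖² = energy C/√s ≥ (energy C)^{3/2}/√M`; the tested form of the
crux is the realTrigPoly dictionary of `galerkinRHS = 0` (as in `exists_steady_galerkin_approx`). -/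
theorem transfer : LoudCoatDecades →
    Summit.AnomalousDissipation.AnomalousDissipation.Theses.MirrorVariety.GalerkinSteadyZerothLaw := by
  sorry

end

end Summit.AnomalousDissipation.AnomalousDissipation.Cruxes.GalerkinSteadyZerothLaw.EulerCoreCoatReadout
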